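import Literature.MathematicalPhysics.QuantumFieldTheory.Balaban1983to89.B8Eq191FlatDirichletLateral
import Mathlib.Analysis.SpecificLimits.Normed

/-!
# `Balaban1983to89.B8Eq191FlatDirichletCounting` — [Balaban1984PropagatorsII] Lemma 2.1 (2.61) p. 234 «sup_{y∈𝔅} Σ_{y′∈𝔅} e^{−αδ₀d(y,y′)} ≤ c₁(α)» FOR THE TOWER-SCALED SITE
# DISTANCE ON THE CUBE MEMBER `{□_j}` of [Balaban1985RegularSpaces] (1.131): ball cardinality and THE COUNTING LEMMA
# `Σ_{z∈□₀} e^{−2δ′d_σ(x,z)} ≤ 3ᵈ·L^{d(jₓ+1)}·L^{d∕ρ}·Σ_R (R+1)ᵈ(e^{−2δ′}L^{d∕ρ})ᴿ` — finite exactly under the MARGIN THRESHOLD `e^{−2δ′}·L^{d∕ρ} < 1` of bus «LOCATED-ρ»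
# (brick 4c, part 2, of the (R1′) programme of DAG node N05)

statement-level skeleton of published theorems with citation tags; proofs where landed; nothing here is a claim about the
Yang–Mills mass gap

T. Bałaban, *Propagators and renormalization transformations for lattice gauge theories. II*, Commun. Math. Phys. **96** (1984) 223–250 `[Balaban1984PropagatorsII]` ("B6"):
(2.2) p. 224 («R is a big positive integer fixed later»), (2.46) p. 231, Lemma 2.1 (2.60)–(2.61) p. 234; T. Bałaban, *Spaces of regular gauge field configurations …*,
Commun. Math. Phys. **99** (1985) 75–102 `[Balaban1985RegularSpaces]` ("B8"): p. 98 («R₁, M₁ are smallest integers for which all the theorems of the papers [2, 4] are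
valid»), (1.131) p. 99.

CITATION HEADER (lean-in-tree rule).  Cell `pub-ymgap` (YM Track A, HUMAN RULING D-0062), DAG node N05 = [B8], seat `pub-ymgap-dag-n05-c` (g8), programme (R1′) (memo
`R1PRIME-PROGRAMME.md`, seat HOME).  Brick 4c part 1 (`B8Eq191FlatDirichletLateral`) proved LATERAL CONFINEMENT: the `d_σ`-ball of radius `R` about a site of tower level
`jₓ` lies in the box of half-width `R·L^{jₓ+1+⌊R∕ρ⌋}`.  THIS FILE turns it into the COUNTING LEMMA the `ℓ² → ℓ^∞` step (brick 5) needs, and makes the margin threshold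
of bus «LOCATED-ρ» (INBOX l.19153) a DISPLAYED HYPOTHESIS: the majorant series converges iff `e^{−2δ′}·L^{d∕ρ} < 1`, i.e. `ρ > d·ln L∕(2δ′)` with brick 3's `δ′(θ, a₀, d)`.

WHAT THIS FILE PROVES (theorems only; 0 `def`).
* §1 (private `card_Icc_box`: `#[c − w, c + w]ᵈ = (2w+1)ᵈ`), ★★ `card_ball_le` (`#{z ∈ □₀ : d_σ(x,z) < R} ≤ (2⌊R·L^{jₓ+1+⌊R∕ρ⌋}⌋ + 1)ᵈ`).
* §2 `summable_succ_pow_mul_geometric` (`Σ_R (R+1)ᵈbᴿ < ∞` for `0 ≤ b < 1`, from Mathlib's `summable_pow_mul_geometric_of_norm_lt_one`), ★★★ **`expSum_le`**: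
  `Σ_{z∈□₀} e^{−2δ′d_σ(x,z)} ≤ 3ᵈ·L^{d(jₓ+1)}·L^{d∕ρ}·Σ'_R (R+1)ᵈ·(e^{−2δ′}L^{d∕ρ})ᴿ` under `e^{−2δ′}L^{d∕ρ} < 1` (shells `⌊d_σ⌋ = R` ⊂ balls of radius `R+1`; `2⌊y⌋+1 ≤ 3y`;
  `L^{⌊q⌋} ≤ L^q`; `Summable.sum_le_tsum`).  The constant depends on `d, L, ρ, δ′` only — uniform in `k, η, M, n` and the cube's position; the factor `L^{d·jₓ}` is the volume of
  one correlation cell at the level of `x` (print's (2.61) counts BLOCKS, hence has no such factor).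

HONEST SCOPE.  Counting only; NOT (1.101) — the `ℓ² → ℓ^∞` step (brick 5, with the d = 4 caveat of the memo) and (1.92)∕(1.98) (brick 6) remain; the weights of brick 5's
application (`L^{2(jₓ−j(z))}`-type level factors) are absorbed the same way using the level confinement of `B8Eq191FlatDirichletLateral.walkCost_ge_excursion` — not typed
here.  Count-neutral; N05 NOT discharged; one finite `T⁴` programme at fixed `ε`, Bałaban as printed; nothing continuum ∕ ℝ⁴ ∕ OS ∕ mass-gap ∕ Clay.  No `sorry`, no `def`, no
`instance`, no `notation`.  Unit `pub-ymgap-dag-n05-c` (g8), 2026-08-27.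

RELATED IN THE TREE, NOT DUPLICATED: `B6Ineq261LevelGap` (p21: Lemma 2.1 on the Neumann-box BLOCK carrier, `K261`, `theta_lt_one_of_log` — the block-level model; other carrier),
`B6Geom246MultiLevelTorus` (torus version), Mathlib `summable_pow_mul_geometric_of_norm_lt_one` (USED).
-/

noncomputable section

namespace Literature.MathematicalPhysics.QuantumFieldTheory.Balaban1983to89.B8Eq191FlatDirichletCounting

open Finset
open B7Prop1Explicit (e)
open Literature.MathematicalPhysics.QuantumLattice (blockMap)
open B8Eq131CubesAdmissible (cubeFam)
open B8CubeMemberZd (cubeLamS)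
open B8Eq191FlatDirichletDistance (nnGraph lsDist lsDist_nonneg towerScale_nonneg)
open B8Eq191FlatDirichletLateral (lateral_le_of_lsDist_lt)

variable {d : ℕ}

/-! ## §1 The scaled-distance ball of radius `R` about a site of tower level `jₓ` holds at most `(2⌊R·L^{jₓ+1+⌊R∕ρ⌋}⌋ + 1)ᵈ` sites -/

/-- Cardinality of an integer box `[c − w, c + w]ᵈ`: `(2w + 1)ᵈ`. [folklore] -/
private theorem card_Icc_box (c : Fin d → ℤ) (w : ℕ) :
    (Finset.Icc (c - fun _ => (w : ℤ)) (c + fun _ => (w : ℤ))).card = (2 * w + 1) ^ d := by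
  rw [Pi.card_Icc]
  simp only [Pi.sub_apply, Pi.add_apply, Int.card_Icc]
  have h : ∀ i : Fin d, (c i + (w : ℤ) + 1 - (c i - (w : ℤ))).toNat = 2 * w + 1 := by
    intro i
    rw [show c i + (w : ℤ) + 1 - (c i - (w : ℤ)) = ((2 * w + 1 : ℕ) : ℤ) by push_cast; ring, Int.toNat_natCast]
  rw [Finset.prod_congr rfl fun i _ => h i, Finset.prod_const, Finset.card_univ, Fintype.card_fin]

open Classical in
/-- **BALL CARDINALITY** (the volume side of [B6] Lemma 2.1 on the cube member): the sites of `□₀` at tower-scaled distance `< R` from a site `x` of tower level `jₓ` number at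
most `(2⌊R·L^{jₓ+1+⌊R∕ρ⌋}⌋ + 1)ᵈ` — by LATERAL CONFINEMENT they lie in the box of that half-width about `x`. [cite: Balaban1984PropagatorsII, (2.46) p.231, Lemma 2.1 (2.61) p.234; Balaban1985RegularSpaces, (1.131) p.99] -/
theorem card_ball_le (hd : 0 < d) {L : ℕ} (hL : 1 ≤ L) (a : Fin d → ℤ) (M : ℕ) {ρ : ℕ} (hρ : L ≤ ρ) {k n : ℕ} (hn : n ≤ k)
    (S : Finset (Fin d → ℤ)) (hS : ∀ x, x ∈ S ↔ x ∈ cubeFam false L a M ρ k 0) {x : Fin d → ℤ} (hx : x ∈ S)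
    {jx : ℕ} (hjx : jx ≤ n) (hxj : blockMap (L ^ jx) x ∈ cubeLamS L a M ρ k n jx) (R : ℝ) :
    (S.filter (fun z => lsDist S (fun y => ∑ j' ∈ Finset.range (n + 1),
        (if blockMap (L ^ j') y ∈ cubeLamS L a M ρ k n j' then (((L : ℝ) ^ j'))⁻¹ else 0)) x z < R)).card
      ≤ (2 * ⌊R * (L : ℝ) ^ (jx + 1 + ⌊R / ρ⌋₊)⌋₊ + 1) ^ d := by
  set w : ℕ := ⌊R * (L : ℝ) ^ (jx + 1 + ⌊R / ρ⌋₊)⌋₊ with hw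
  refine le_trans (Finset.card_le_card ?_) (le_of_eq (card_Icc_box x w))
  intro z hz
  obtain ⟨hzS, hzR⟩ := Finset.mem_filter.mp hz
  rw [Finset.mem_Icc]
  have hcoord : ∀ ν : Fin d, |x ν - z ν| ≤ (w : ℤ) := by
    intro ν
    have h := lateral_le_of_lsDist_lt S hd hL a M hρ hn hS hx hzS hjx hxj hzR ν
    have h1 : (((x ν - z ν).natAbs : ℕ) : ℝ) ≤ R * (L : ℝ) ^ (jx + 1 + ⌊R / ρ⌋₊) := by
      have : (((x ν - z ν).natAbs : ℕ) : ℝ) = |((x ν : ℤ) : ℝ) - ((z ν : ℤ) : ℝ)| := by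
        rw [← Int.cast_natCast, Int.natCast_natAbs, Int.cast_abs, Int.cast_sub]
      rw [this]; exact h
    have h2 : (x ν - z ν).natAbs ≤ w := Nat.le_floor h1
    rw [← Int.natCast_natAbs]
    exact_mod_cast h2
  constructor
  · intro ν; simp only [Pi.sub_apply]; have := (abs_le.mp (hcoord ν)).2; linarith [(abs_le.mp (hcoord ν)).1]
  · intro ν; simp only [Pi.add_apply]; linarith [(abs_le.mp (hcoord ν)).1, (abs_le.mp (hcoord ν)).2]

/-! ## §2 The counting lemma: `Σ_{z∈□₀} e^{−2δ′d_σ(x,z)} ≤ C(d,L,ρ,δ′)·L^{d(jₓ+1)}` under the margin threshold `e^{−2δ′}·L^{d∕ρ} < 1` -/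

/-- The majorant series of the counting lemma is summable iff-type condition: for `0 ≤ b < 1`, `Σ_R (R+1)ᵈ bᴿ < ∞`. [folklore]
[cite: Balaban1984PropagatorsII, Lemma 2.1 (2.61) p.234] -/
theorem summable_succ_pow_mul_geometric {b : ℝ} (hb0 : 0 ≤ b) (hb : b < 1) :
    Summable (fun R : ℕ => ((R : ℝ) + 1) ^ d * b ^ R) := by
  have h := summable_pow_mul_geometric_of_norm_lt_one (R := ℝ) d (r := b) (by rw [Real.norm_eq_abs, abs_of_nonneg hb0]; exact hb)
  -- shift: `(R+1)^d b^R ≤ ?`; use `(R+1)^d b^(R+1) = ((n ↦ n^d b^n) ∘ succ)` and divide by `b` when `b > 0`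
  rcases eq_or_lt_of_le hb0 with hb00 | hbpos
  · -- `b = 0`: the series is finitely supported
    refine summable_of_ne_finset_zero (s := {0}) fun R hR => ?_
    rw [Finset.mem_singleton] at hR
    rw [← hb00, zero_pow hR, mul_zero]
  · have h1 : Summable (fun R : ℕ => (((R + 1 : ℕ) : ℝ)) ^ d * b ^ (R + 1)) := (summable_nat_add_iff 1).mpr h
    have h2 := h1.mul_left b⁻¹
    refine h2.congr fun R => ?_
    push_cast
    rw [pow_succ]
    field_simp

open Classical in
/-- **THE COUNTING LEMMA ON THE CUBE MEMBER** ([B6] Lemma 2.1 (2.61) for the tower-scaled SITE distance, with the volume of one correlation cell as the natural unit): for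
`x ∈ □₀` of tower level `jₓ` and `δ′ > 0`,
`Σ_{z∈□₀} e^{−2δ′·d_σ(x,z)} ≤ 3ᵈ·L^{d(jₓ+1)}·L^{d∕ρ}·Σ_{R≥0} (R+1)ᵈ·(e^{−2δ′}L^{d∕ρ})ᴿ` — FINITE exactly when `e^{−2δ′}·L^{d∕ρ} < 1`, i.e. under the MARGIN THRESHOLD
`ρ > d·ln L ∕ (2δ′)` of bus «LOCATED-ρ» ([B6] (2.2) «R is a big positive integer fixed later»; B8 p. 98 «R₁, M₁ … for which all the theorems of [2, 4] are valid»).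
Mechanism: shell `⌊d_σ⌋ = R` ⊂ ball of radius `R + 1` ⊂ box of half-width `(R+1)L^{jₓ+1+(R+1)∕ρ}` (lateral confinement).
[cite: Balaban1984PropagatorsII, (2.2) p.224, (2.46) p.231, Lemma 2.1 (2.60)–(2.61) p.234; Balaban1985RegularSpaces, p.98, (1.131) p.99] -/
theorem expSum_le (hd : 0 < d) {L : ℕ} (hL : 1 ≤ L) (a : Fin d → ℤ) (M : ℕ) {ρ : ℕ} (hρ : L ≤ ρ) {k n : ℕ} (hn : n ≤ k)
    (S : Finset (Fin d → ℤ)) (hS : ∀ x, x ∈ S ↔ x ∈ cubeFam false L a M ρ k 0) {x : Fin d → ℤ} (hx : x ∈ S)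
    {jx : ℕ} (hjx : jx ≤ n) (hxj : blockMap (L ^ jx) x ∈ cubeLamS L a M ρ k n jx) {δ' : ℝ} (hδ : 0 ≤ δ')
    (hthr : Real.exp (-2 * δ') * (L : ℝ) ^ ((d : ℝ) / ρ) < 1) :
    ∑ z ∈ S, Real.exp (-2 * δ' * lsDist S (fun y => ∑ j' ∈ Finset.range (n + 1),
        (if blockMap (L ^ j') y ∈ cubeLamS L a M ρ k n j' then (((L : ℝ) ^ j'))⁻¹ else 0)) x z)
      ≤ (3 : ℝ) ^ d * (L : ℝ) ^ (d * (jx + 1)) * (L : ℝ) ^ ((d : ℝ) / ρ) *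
          ∑' R : ℕ, ((R : ℝ) + 1) ^ d * (Real.exp (-2 * δ') * (L : ℝ) ^ ((d : ℝ) / ρ)) ^ R := by
  set σ' : (Fin d → ℤ) → ℝ := fun y => ∑ j' ∈ Finset.range (n + 1),
    (if blockMap (L ^ j') y ∈ cubeLamS L a M ρ k n j' then (((L : ℝ) ^ j'))⁻¹ else 0) with hσ'
  set b : ℝ := Real.exp (-2 * δ') * (L : ℝ) ^ ((d : ℝ) / ρ) with hbdef
  have hL1 : (1 : ℝ) ≤ L := by exact_mod_cast hL
  have hL0 : (0 : ℝ) < L := by linarith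
  have hρ0 : (0 : ℝ) < ρ := by exact_mod_cast lt_of_lt_of_le (lt_of_lt_of_le Nat.zero_lt_one hL) hρ
  have hLdρ : (1 : ℝ) ≤ (L : ℝ) ^ ((d : ℝ) / ρ) := Real.one_le_rpow hL1 (by positivity)
  have hb0 : 0 ≤ b := by positivity
  have hdist0 : ∀ z, 0 ≤ lsDist S σ' x z := fun z => lsDist_nonneg S (towerScale_nonneg L n (cubeLamS L a M ρ k n)) x z
  -- the shell index `R(z) = ⌊d_σ(x,z)⌋`
  set Rf : (Fin d → ℤ) → ℕ := fun z => ⌊lsDist S σ' x z⌋₊ with hRf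
  -- per shell: `e^{-2δ′d} ≤ e^{-2δ′R}` and `#shell ≤ #ball(R+1) ≤ (3(R+1)L^{jx+1}L^{(R+1)/ρ})^d`
  have hshell : ∀ R : ℕ, ∑ z ∈ S.filter (fun z => Rf z = R), Real.exp (-2 * δ' * lsDist S σ' x z)
      ≤ Real.exp (-2 * δ' * R) * ((3 : ℝ) * ((R : ℝ) + 1) * (L : ℝ) ^ (jx + 1) * (L : ℝ) ^ (((R : ℝ) + 1) / ρ)) ^ d := by
    intro R
    have hterm : ∀ z ∈ S.filter (fun z => Rf z = R), Real.exp (-2 * δ' * lsDist S σ' x z) ≤ Real.exp (-2 * δ' * R) := by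
      intro z hz
      obtain ⟨-, hzR⟩ := Finset.mem_filter.mp hz
      refine Real.exp_le_exp.mpr ?_
      have : (R : ℝ) ≤ lsDist S σ' x z := by rw [← hzR]; exact Nat.floor_le (hdist0 z)
      nlinarith
    have hcard : ((S.filter (fun z => Rf z = R)).card : ℝ) ≤ ((3 : ℝ) * ((R : ℝ) + 1) * (L : ℝ) ^ (jx + 1) * (L : ℝ) ^ (((R : ℝ) + 1) / ρ)) ^ d := by
      have hsub : S.filter (fun z => Rf z = R) ⊆ S.filter (fun z => lsDist S σ' x z < (R : ℝ) + 1) := by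
        intro z hz
        obtain ⟨hzS, hzR⟩ := Finset.mem_filter.mp hz
        refine Finset.mem_filter.mpr ⟨hzS, ?_⟩
        have := Nat.lt_floor_add_one (lsDist S σ' x z)
        rw [hRf] at hzR; simp only at hzR; rw [hzR] at this; exact_mod_cast this
      have h1 := Finset.card_le_card hsub
      have h2 := card_ball_le hd hL a M hρ hn S hS hx hjx hxj ((R : ℝ) + 1)
      have h3 : ((S.filter (fun z => Rf z = R)).card : ℝ) ≤ ((2 * ⌊((R : ℝ) + 1) * (L : ℝ) ^ (jx + 1 + ⌊((R : ℝ) + 1) / ρ⌋₊)⌋₊ + 1 : ℕ) : ℝ) ^ d := by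
        exact_mod_cast h1.trans h2
      refine h3.trans (pow_le_pow_left₀ (by positivity) ?_ d)
      -- `2⌊y⌋ + 1 ≤ 3y` for `y = (R+1)·L^{jx+1+⌊(R+1)/ρ⌋} ≥ 1`, and `L^{⌊q⌋} ≤ L^q`
      have hy1 : (1 : ℝ) ≤ ((R : ℝ) + 1) * (L : ℝ) ^ (jx + 1 + ⌊((R : ℝ) + 1) / ρ⌋₊) :=
        one_le_mul_of_one_le_of_one_le (by linarith [(Nat.cast_nonneg R : (0 : ℝ) ≤ R)]) (one_le_pow₀ hL1)
      have hfl : ((⌊((R : ℝ) + 1) * (L : ℝ) ^ (jx + 1 + ⌊((R : ℝ) + 1) / ρ⌋₊)⌋₊ : ℕ) : ℝ)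
          ≤ ((R : ℝ) + 1) * (L : ℝ) ^ (jx + 1 + ⌊((R : ℝ) + 1) / ρ⌋₊) := Nat.floor_le (by positivity)
      have hpow : (L : ℝ) ^ (jx + 1 + ⌊((R : ℝ) + 1) / ρ⌋₊) ≤ (L : ℝ) ^ (jx + 1) * (L : ℝ) ^ (((R : ℝ) + 1) / ρ) := by
        rw [pow_add]
        refine mul_le_mul_of_nonneg_left ?_ (by positivity)
        calc (L : ℝ) ^ ⌊((R : ℝ) + 1) / ρ⌋₊ = (L : ℝ) ^ ((⌊((R : ℝ) + 1) / ρ⌋₊ : ℕ) : ℝ) := (Real.rpow_natCast _ _).symm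
          _ ≤ (L : ℝ) ^ (((R : ℝ) + 1) / ρ) := Real.rpow_le_rpow_of_exponent_le hL1 (Nat.floor_le (by positivity))
      push_cast
      nlinarith [hfl, hpow, hy1, mul_le_mul_of_nonneg_left hpow (show (0:ℝ) ≤ (R : ℝ) + 1 by positivity)]
    calc ∑ z ∈ S.filter (fun z => Rf z = R), Real.exp (-2 * δ' * lsDist S σ' x z)
        ≤ ∑ z ∈ S.filter (fun z => Rf z = R), Real.exp (-2 * δ' * R) := Finset.sum_le_sum hterm
      _ = ((S.filter (fun z => Rf z = R)).card : ℝ) * Real.exp (-2 * δ' * R) := by rw [Finset.sum_const, nsmul_eq_mul]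
      _ ≤ _ := by rw [mul_comm]; exact mul_le_mul_of_nonneg_left hcard (Real.exp_pos _).le
  -- the majorant `g R` and its algebra
  have hg : ∀ R : ℕ, Real.exp (-2 * δ' * R) * ((3 : ℝ) * ((R : ℝ) + 1) * (L : ℝ) ^ (jx + 1) * (L : ℝ) ^ (((R : ℝ) + 1) / ρ)) ^ d
      = (3 : ℝ) ^ d * (L : ℝ) ^ (d * (jx + 1)) * (L : ℝ) ^ ((d : ℝ) / ρ) * (((R : ℝ) + 1) ^ d * b ^ R) := by
    intro R
    have hexp : Real.exp (-2 * δ' * R) = Real.exp (-2 * δ') ^ R := by rw [← Real.exp_nat_mul]; ring_nf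
    have hrp : ((L : ℝ) ^ (((R : ℝ) + 1) / ρ)) ^ d = (L : ℝ) ^ ((d : ℝ) / ρ) * ((L : ℝ) ^ ((d : ℝ) / ρ)) ^ R := by
      rw [← Real.rpow_natCast, ← Real.rpow_mul hL0.le, ← Real.rpow_natCast, ← Real.rpow_mul hL0.le, ← Real.rpow_add hL0]
      congr 1; field_simp; ring
    rw [hexp, mul_pow, mul_pow, mul_pow, hrp, hbdef, mul_pow, ← pow_mul]
    ring
  -- summing the shells
  have hsum : ∑ z ∈ S, Real.exp (-2 * δ' * lsDist S σ' x z)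
      = ∑ R ∈ S.image Rf, ∑ z ∈ S.filter (fun z => Rf z = R), Real.exp (-2 * δ' * lsDist S σ' x z) :=
    (Finset.sum_fiberwise_of_maps_to (g := Rf) (fun z hz => Finset.mem_image_of_mem Rf hz) _).symm
  have hsumm : Summable (fun R : ℕ => ((R : ℝ) + 1) ^ d * b ^ R) := summable_succ_pow_mul_geometric hb0 hthr
  rw [hsum]
  calc ∑ R ∈ S.image Rf, ∑ z ∈ S.filter (fun z => Rf z = R), Real.exp (-2 * δ' * lsDist S σ' x z)
      ≤ ∑ R ∈ S.image Rf, (3 : ℝ) ^ d * (L : ℝ) ^ (d * (jx + 1)) * (L : ℝ) ^ ((d : ℝ) / ρ) * (((R : ℝ) + 1) ^ d * b ^ R) :=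
        Finset.sum_le_sum fun R _ => (hshell R).trans (le_of_eq (hg R))
    _ = (3 : ℝ) ^ d * (L : ℝ) ^ (d * (jx + 1)) * (L : ℝ) ^ ((d : ℝ) / ρ) * ∑ R ∈ S.image Rf, ((R : ℝ) + 1) ^ d * b ^ R := by
        rw [Finset.mul_sum]
    _ ≤ (3 : ℝ) ^ d * (L : ℝ) ^ (d * (jx + 1)) * (L : ℝ) ^ ((d : ℝ) / ρ) * ∑' R : ℕ, ((R : ℝ) + 1) ^ d * b ^ R := by
        refine mul_le_mul_of_nonneg_left ?_ (by positivity)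
        exact hsumm.sum_le_tsum _ fun R _ => by positivity

end Literature.MathematicalPhysics.QuantumFieldTheory.Balaban1983to89.B8Eq191FlatDirichletCounting

end
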